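import Summits.QuantumFields.QCD.Theses.QuarkMassMonotone
import Literature.MathematicalPhysics.QuantumFieldTheory.QCDOS
import Literature.MathematicalPhysics.QuantumFieldTheory.QCDPhaseQuenched
import Literature.MathematicalPhysics.QuantumFieldTheory.QCDSiteReflectionPositivityProofs
import Literature.MathematicalPhysics.QuantumLattice.GrassmannCoefficientRegularity
import Literature.MathematicalPhysics.QuantumLattice.GrassmannGaussianMeasureChange
import Literature.MathematicalPhysics.QuantumLattice.GrassmannGaussianChargeRule
import HarnessLib

/-!
# The Feynman–Hellmann identity in the quark mass from the mass-update formula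
(stub `stub_massDerivativeIdentity_of_update`, crux `HeatSlicedQuarks.RobustYangMillsHandover`,
stmt-QuantumFields-8892, line `pin-the-infimum`; second half of the split of item stmt-QuantumFields-8909
`QuarkMassMonotone.MassDerivativeIdentity`)

Given the mass-update formula for the fermionic Boltzmann factor on the four-torus,
`e^{−ψ̄D(U, m[f ↦ μ])ψ} = e^{−ψ̄D(U, m)ψ} · exp(−(μ − m_f) Σ_f)` with the flavour-`f` scalar density
`Σ_f = Σ_{x,a,α} ψ̄_{f,x,a,α} ψ_{f,x,a,α} = ψ̄ P_f ψ` a quadratic (hence central and nilpotent) Grassmann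
element, the honest finite-torus lattice-QCD expectation `μ ↦ ⟨A⟩_{β, 2S+1, m[f ↦ μ]}` of every
gauge-invariant local observable `A` is differentiable at `μ = m_f` with derivative
`−(⟨A Σ_f⟩ − ⟨A⟩⟨Σ_f⟩)` whenever the fermionic partition function does not vanish.

Proof: `Σ_f` is nilpotent, so `exp(−(μ − m_f) Σ_f) = Σ_{i<K} ((μ − m_f)^i (−1)^i / i!) Σ_f^i` is a
polynomial in `μ` with Grassmann coefficients; the Berezin integral is linear and every
`U ↦ ∫dψ̄dψ Y(U) Σ_f^i` with coefficient-regular `Y` is bounded and measurable, hence integrable against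
the Wilson probability measure, so numerator and denominator of `⟨A⟩` are complex polynomials in `μ`
whose derivative at `μ = m_f` is the `i = 1` coefficient; the quotient rule and centrality of `Σ_f`
finish.  Everything is proved; no named fact. [folklore]
-/

noncomputable section

open MeasureTheory Filter Function Matrix
open Literature.MathematicalPhysics.QuantumFieldTheory Literature.MathematicalPhysics.QuantumLattice
open Literature.Probability.LatticeModels
open Literature.MathematicalPhysics.QuantumLattice.GrassmannAlgebra

namespace Summit.QuantumFields.QCD.Cruxes.RobustYangMillsHandover.PinTheInfimum

namespace StubMassDerivativeOfUpdate

variable {Nf S : ℕ} [NeZero S]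

/-- The fermionic Boltzmann factor `U ↦ e^{−ψ̄D(U,m)ψ}` is coefficient-regular: the entries of `D(U, m)`
are continuous in `U` and a quadratic form has no constant term. -/
theorem coeffRegular_fermiBoltzmann (mq : Fin Nf → ℝ) :
    CoeffRegular (fun U : GaugeConfig 4 S (Matrix.specialUnitaryGroup (Fin 3) ℂ) => fermiBoltzmann U mq) := by
  unfold fermiBoltzmann
  exact (coeffRegular_quadratic fun p q =>
    (continuous_diracMatrix mq).neg.matrix_elem p q).grassmannExp fun U => coord_empty_quadratic _

/-- The placed observable `U ↦ A.onTorus S v U` is coefficient-regular (a fixed algebra map applied to the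
boxed observable read through the measurable translated periodic lift). -/
theorem coeffRegular_onTorus {R : ℕ} (A : QCDLatticeObservable Nf R) (v : Site 4) :
    CoeffRegular (fun U : GaugeConfig 4 S (Matrix.specialUnitaryGroup (Fin 3) ℂ) => A.onTorus S v U) := by
  unfold QCDLatticeObservable.onTorus
  exact ((coeffRegular_boxObs A).comp
    ((Literature.MathematicalPhysics.QuantumLattice.configShift _).measurable.comp
      (measurable_torusLift S))).algHom _

/-- The Berezin integral of a coefficient-regular Grassmann-valued variable (bounded and measurable) is
integrable against every finite measure. -/
theorem integrable_fermiIntegral {Y : GaugeConfig 4 S (Matrix.specialUnitaryGroup (Fin 3) ℂ) → FermiAlg Nf S}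
    (hY : CoeffRegular Y) (μW : Measure (GaugeConfig 4 S (Matrix.specialUnitaryGroup (Fin 3) ℂ)))
    [IsFiniteMeasure μW] : Integrable (fun U => fermiIntegral (Y U)) μW := by
  obtain ⟨C, hC⟩ := hY.exists_norm_apply_le fermiIntegral
  exact Integrable.of_bound (hY.measurable_apply fermiIntegral).aestronglyMeasurable C
    (Eventually.of_forall hC)

/-- The exponential of a scalar multiple of a nilpotent Grassmann element, as a finite sum:
`σ ^ K = 0 ⟹ exp(−cσ) = Σ_{i<K} ((i!)⁻¹ (−c)^i) • σ^i`. -/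
theorem grassmannExp_neg_smul_eq_sum {σ : FermiAlg Nf S} {K : ℕ} (hK : σ ^ K = 0) (c : ℂ) :
    grassmannExp (-(c • σ)) = ∑ i ∈ Finset.range K, (((i.factorial : ℂ))⁻¹ * (-c) ^ i) • σ ^ i := by
  have h0 : (-(c • σ)) ^ K = 0 := by rw [← neg_smul, smul_pow, hK, smul_zero]
  rw [grassmannExp, IsNilpotent.exp_eq_sum h0]
  refine Finset.sum_congr rfl fun i _ => ?_
  rw [← neg_smul, smul_pow, inv_natCast_smul_eq ℚ ℂ, smul_smul]

/-- **Linear exchange**: for coefficient-regular `Y` and `σ ^ K = 0`,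
`∫dμ ∫dψ̄dψ Y(U) exp(−cσ) = Σ_{i<K} (i!)⁻¹ (−c)^i ∫dμ ∫dψ̄dψ Y(U) σ^i` (the Berezin integral is linear and the
Bochner integral against a finite measure commutes with the finite sum of bounded measurable terms). -/
theorem integral_fermiIntegral_mul_grassmannExp_eq_sum
    (μW : Measure (GaugeConfig 4 S (Matrix.specialUnitaryGroup (Fin 3) ℂ))) [IsFiniteMeasure μW]
    {Y : GaugeConfig 4 S (Matrix.specialUnitaryGroup (Fin 3) ℂ) → FermiAlg Nf S} (hY : CoeffRegular Y)
    {σ : FermiAlg Nf S} {K : ℕ} (hK : σ ^ K = 0) (c : ℂ) :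
    ∫ U, fermiIntegral (Y U * grassmannExp (-(c • σ))) ∂μW =
      ∑ i ∈ Finset.range K, ((i.factorial : ℂ))⁻¹ * (-c) ^ i * ∫ U, fermiIntegral (Y U * σ ^ i) ∂μW := by
  have h : ∀ U, fermiIntegral (Y U * grassmannExp (-(c • σ))) =
      ∑ i ∈ Finset.range K, ((i.factorial : ℂ))⁻¹ * (-c) ^ i * fermiIntegral (Y U * σ ^ i) := fun U => by
    rw [grassmannExp_neg_smul_eq_sum hK, Finset.mul_sum, map_sum]
    exact Finset.sum_congr rfl fun i _ => by rw [mul_smul_comm, map_smul, smul_eq_mul]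
  simp_rw [h]
  rw [integral_finsetSum _ fun i _ =>
    (integrable_fermiIntegral (hY.mul (coeffRegular_const _)) μW).const_mul _]
  exact Finset.sum_congr rfl fun i _ => integral_const_mul _ _

/-- **Feynman–Hellmann engine.** For coefficient-regular `Y` and nilpotent `σ`, the un-normalised functional
`μ ↦ ∫dμ_W ∫dψ̄dψ Y(U) exp(−(μ − a)σ)` has derivative `−∫dμ_W ∫dψ̄dψ Y(U) σ` at `μ = a` (it is the complex
polynomial `Σ_i (i!)⁻¹ (a − μ)^i C_i`, `C_i = ∫∫ Y σ^i`, and only `i = 1` survives at `μ = a`). -/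
theorem hasDerivAt_integral_fermiIntegral_mul_grassmannExp
    (μW : Measure (GaugeConfig 4 S (Matrix.specialUnitaryGroup (Fin 3) ℂ))) [IsFiniteMeasure μW]
    {Y : GaugeConfig 4 S (Matrix.specialUnitaryGroup (Fin 3) ℂ) → FermiAlg Nf S} (hY : CoeffRegular Y)
    {σ : FermiAlg Nf S} (hσ : IsNilpotent σ) (a : ℝ) :
    HasDerivAt (fun μ : ℝ => ∫ U, fermiIntegral (Y U * grassmannExp (-(((μ - a : ℝ) : ℂ) • σ))) ∂μW)
      (-(∫ U, fermiIntegral (Y U * σ) ∂μW)) a := by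
  obtain ⟨k, hk⟩ := hσ
  have hK : σ ^ (k + 2) = 0 := pow_eq_zero_of_le (by omega) hk
  have hfun : (fun μ : ℝ => ∫ U, fermiIntegral (Y U * grassmannExp (-(((μ - a : ℝ) : ℂ) • σ))) ∂μW) =
      fun μ : ℝ => ∑ i ∈ Finset.range (k + 2), ((i.factorial : ℂ))⁻¹ * (-((μ - a : ℝ) : ℂ)) ^ i *
        ∫ U, fermiIntegral (Y U * σ ^ i) ∂μW :=
    funext fun μ => integral_fermiIntegral_mul_grassmannExp_eq_sum μW hY hK _
  rw [hfun]
  have h1 : HasDerivAt (fun μ : ℝ => -((μ - a : ℝ) : ℂ)) (-1) a := by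
    have h := (((hasDerivAt_id' a).sub_const a).ofReal_comp).fun_neg
    rwa [Complex.ofReal_one] at h
  have he : ∀ i : ℕ, HasDerivAt (fun μ : ℝ => ((i.factorial : ℂ))⁻¹ * (-((μ - a : ℝ) : ℂ)) ^ i *
        ∫ U, fermiIntegral (Y U * σ ^ i) ∂μW)
      (((i.factorial : ℂ))⁻¹ * ((i : ℂ) * (-((a - a : ℝ) : ℂ)) ^ (i - 1) * (-1)) *
        ∫ U, fermiIntegral (Y U * σ ^ i) ∂μW) a := fun i =>
    ((h1.fun_pow i).const_mul _).mul_const _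
  refine (HasDerivAt.fun_sum fun i _ => he i).congr_deriv ?_
  rw [Finset.sum_eq_single 1 ?_ fun h => absurd (by simp) h]
  · simp
  · intro i _ hi
    rw [sub_self, Complex.ofReal_zero, neg_zero]
    rcases i with _ | _ | i
    · simp
    · exact absurd rfl hi
    · simp

/-- **The Feynman–Hellmann identity for an abstract coefficient-regular insertion.** If the fermionic
Boltzmann factor obeys the mass-update formula with a central nilpotent `σ`, then for every
coefficient-regular `X`, `μ ↦ ⟨X⟩_{β,S,m[f↦μ]}` has derivative `−(⟨Xσ⟩ − ⟨X⟩⟨σ⟩)` at `μ = m_f`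
(quotient rule over the engine, provided the fermionic partition function is non-zero). -/
theorem hasDerivAt_qcdTorusExpect (β : ℝ) (mq : Fin Nf → ℝ) (f : Fin Nf)
    {X : GaugeConfig 4 S (Matrix.specialUnitaryGroup (Fin 3) ℂ) → FermiAlg Nf S} (hX : CoeffRegular X)
    {σ : FermiAlg Nf S} (hnil : IsNilpotent σ) (hcomm : ∀ z, Commute σ z)
    (hupd : ∀ (U : GaugeConfig 4 S (Matrix.specialUnitaryGroup (Fin 3) ℂ)) (μ : ℝ),
      fermiBoltzmann U (Function.update mq f μ) =
        fermiBoltzmann U mq * grassmannExp (-(((μ - mq f : ℝ) : ℂ) • σ)))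
    (hZ : (∫ U, fermiIntegral (fermiBoltzmann U mq)
      ∂(wilsonMeasure (d := 4) (L := S) (fundamentalRep (Fin 3)) β)) ≠ 0) :
    HasDerivAt (fun μ : ℝ => qcdTorusExpect β S (Function.update mq f μ) X)
      (-(qcdTorusExpect β S mq (fun U => X U * σ) -
        qcdTorusExpect β S mq X * qcdTorusExpect β S mq (fun _ => σ))) (mq f) := by
  have hB := coeffRegular_fermiBoltzmann (S := S) mq
  have hN : HasDerivAt (fun μ : ℝ => ∫ U, fermiIntegral (X U * fermiBoltzmann U (Function.update mq f μ))
        ∂(wilsonMeasure (d := 4) (L := S) (fundamentalRep (Fin 3)) β))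
      (-(∫ U, fermiIntegral (X U * fermiBoltzmann U mq * σ)
        ∂(wilsonMeasure (d := 4) (L := S) (fundamentalRep (Fin 3)) β))) (mq f) := by
    refine (hasDerivAt_integral_fermiIntegral_mul_grassmannExp _ (hX.mul hB) hnil (mq f)).congr_of_eventuallyEq
      (Eventually.of_forall fun μ => ?_)
    simp only [hupd, mul_assoc]
  have hD : HasDerivAt (fun μ : ℝ => ∫ U, fermiIntegral (fermiBoltzmann U (Function.update mq f μ))
        ∂(wilsonMeasure (d := 4) (L := S) (fundamentalRep (Fin 3)) β))
      (-(∫ U, fermiIntegral (fermiBoltzmann U mq * σ)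
        ∂(wilsonMeasure (d := 4) (L := S) (fundamentalRep (Fin 3)) β))) (mq f) := by
    refine (hasDerivAt_integral_fermiIntegral_mul_grassmannExp _ hB hnil (mq f)).congr_of_eventuallyEq
      (Eventually.of_forall fun μ => ?_)
    simp only [hupd]
  have hD0 : (∫ U, fermiIntegral (fermiBoltzmann U (Function.update mq f (mq f)))
      ∂(wilsonMeasure (d := 4) (L := S) (fundamentalRep (Fin 3)) β)) ≠ 0 := by
    simpa only [Function.update_eq_self] using hZ
  have e1 : ∀ U : GaugeConfig 4 S (Matrix.specialUnitaryGroup (Fin 3) ℂ),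
      X U * σ * fermiBoltzmann U mq = X U * fermiBoltzmann U mq * σ := fun U => by
    rw [mul_assoc, (hcomm _).eq, ← mul_assoc]
  have e2 : ∀ U : GaugeConfig 4 S (Matrix.specialUnitaryGroup (Fin 3) ℂ),
      σ * fermiBoltzmann U mq = fermiBoltzmann U mq * σ := fun U => (hcomm _).eq
  unfold qcdTorusExpect
  refine (hN.div hD hD0).congr_deriv ?_
  simp only [Function.update_eq_self, e1, e2]
  field_simp
  ring

end StubMassDerivativeOfUpdate

open StubMassDerivativeOfUpdate in
/-- **W1b: the Feynman–Hellmann identity (item stmt-QuantumFields-8909) from the mass-update formula W1a.**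
Given, on every torus, that the flavour-`f` scalar density `Σ_f = Σ_{x,a,α} ψ̄_{f,x,a,α}ψ_{f,x,a,α}` is the
quadratic element `ψ̄ P_f ψ` of the flavour-`f` indicator matrix and that
`e^{−ψ̄D(U,m[f↦μ])ψ} = e^{−ψ̄D(U,m)ψ} exp(−(μ − m_f)Σ_f)`, the map `μ ↦ ⟨A⟩_{β,2S+1,m[f↦μ]}` has derivative
`−(⟨AΣ_f⟩ − ⟨A⟩⟨Σ_f⟩)` at `μ = m_f` whenever the fermionic partition function is non-zero. -/
theorem stub_massDerivativeIdentity_of_update :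
    (∀ (Nf S : ℕ) [NeZero S] (mq : Fin Nf → ℝ) (f : Fin Nf),
      (quadratic ℂ (Matrix.diagonal fun i : FermiIdx Nf S => if (quarkEquiv.symm i).1 = f then (1 : ℂ) else 0) =
          ∑ x : TorusSite 4 S, ∑ a : Fin 3, ∑ α : Fin 4, qbar (f, (x, a, α)) * q (f, (x, a, α))) ∧
      ∀ (U : GaugeConfig 4 S (Matrix.specialUnitaryGroup (Fin 3) ℂ)) (μ : ℝ),
        fermiBoltzmann U (Function.update mq f μ) =
          fermiBoltzmann U mq *
            grassmannExp (-(((μ - mq f : ℝ) : ℂ) •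
              ∑ x : TorusSite 4 S, ∑ a : Fin 3, ∑ α : Fin 4, qbar (f, (x, a, α)) * q (f, (x, a, α))))) →
    Summit.QuantumFields.QCD.Theses.QuarkMassMonotone.MassDerivativeIdentity := by
  intro h Nf β S mq f R A v hZ
  obtain ⟨hquad, hupd⟩ := h Nf (2 * S + 1) mq f
  exact hasDerivAt_qcdTorusExpect β mq f (coeffRegular_onTorus A v) (hquad ▸ isNilpotent_quadratic ℂ _)
    (fun z => hquad ▸ commute_quadratic ℂ _ z) hupd hZ

end Summit.QuantumFields.QCD.Cruxes.RobustYangMillsHandover.PinTheInfimum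

end
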